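import Summits.HodgeConjecture.HodgeConjecture.Theorems.TorelliForSymmetriesReflectionsDecide
import Summits.HodgeConjecture.HodgeConjecture.Theorems.TorelliForSymmetriesInvolutionsOfMiddle
import HarnessLib

/-!
# Crux `InvolutionsAreCorrespondences` (stmt-HodgeConjecture-11023), line `birth` — stub 1 `stub_reflectionsDecide`,
# and the crux from `MiddleInvolutions` alone

Route `HodgeConjecture/TorelliForSymmetries`; registered skeleton `Cruxes/InvolutionsAreCorrespondences/Lines/birth.lean`
(`InvolutionsAreCorrespondences_of : ReflectionsDecide → MiddleInvolutions → InvolutionsAreCorrespondences`, "double, reflect,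
decide"). Its stub 1 is the route's support item `ReflectionsDecide` (stmt-HodgeConjecture-11028) BY NAME, which is PROVED in
the tree (`Theorems.torelliForSymmetries_reflectionsDecide_proof`, file `TorelliForSymmetriesReflectionsDecide`); the
composition is the route's glue item `InvolutionsOfMiddle` (stmt-HodgeConjecture-14419), also PROVED
(`Theorems.torelliForSymmetries_involutionsOfMiddle_proof`). This file records both facts where the crux's stub registry can
see them:

* `stub_reflectionsDecide : ReflectionsDecide` — the registered stub, VERBATIM, closed by the landed item proof;
* `involutionsAreCorrespondences_of_middleInvolutions : MiddleInvolutions → InvolutionsAreCorrespondences` — the skeleton's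
  composition with stub 1 discharged: the crux (11023) follows from the route's catch-all crux `MiddleInvolutions`
  (stmt-HodgeConjecture-14418, HC-complete) ALONE, by name.

Nothing here is a case of the Hodge conjecture; no definition, no named fact, no sorry.
References: [Kleiman1968AlgebraicCycles] §1.3; [VoisinHodgeI2002] §7.1.2 Def. 7.7, §11.3.3 Lemma 11.41.
-/

noncomputable section

-- every declaration of this problem lives in `Summit.HodgeConjecture.HodgeConjecture.…` (summit = sub-problem)
set_option linter.dupNamespace false

open Summit.HodgeConjecture.HodgeConjecture.Theses.TorelliForSymmetries

namespace Summit.HodgeConjecture.HodgeConjecture.Theorems.InvolutionsAreCorrespondences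

/-- **Stub `stub_reflectionsDecide` of crux `InvolutionsAreCorrespondences` (registered signature, verbatim): the route's
support item `ReflectionsDecide`** — if every `P`-reflection in a Hodge class of `H²ᵖ_B(X)` is induced by a rational algebraic
correspondence on `X × X`, then `Hdgᵖ_B(X) = ℚ · Aᵖ_B(X)` (Hodge–Riemann positivity on rational `(p,p)`-classes, a non-zero
algebraic `ηᵖ`, correspondences preserve algebraic classes). PROVED in the tree: `torelliForSymmetries_reflectionsDecide_proof`.
[cite: VoisinHodgeI2002, §7.1.2 Def. 7.7 and §11.3.3 Lemma 11.41] [cite: Kleiman1968AlgebraicCycles, §1.3] -/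
theorem stub_reflectionsDecide : ReflectionsDecide :=
  torelliForSymmetries_reflectionsDecide_proof

/-- **The crux from `MiddleInvolutions` alone**: the route's glue `InvolutionsOfMiddle`
(`ReflectionsDecide → MiddleInvolutions → InvolutionsAreCorrespondences`, proved: double `X ↦ X × X`, reflect in Hodge classes
of the middle degree, decide) with its first hypothesis discharged. [cite: VoisinHodgeI2002, §11.3.3] [cite: Kleiman1968AlgebraicCycles, §1.3] -/
theorem involutionsAreCorrespondences_of_middleInvolutions :
    MiddleInvolutions → InvolutionsAreCorrespondences :=
  torelliForSymmetries_involutionsOfMiddle_proof stub_reflectionsDecide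

end Summit.HodgeConjecture.HodgeConjecture.Theorems.InvolutionsAreCorrespondences

end
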